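import Mathlib
import Literature.Topology.PlaneTopology.SeparatedCrossings
import Summits.CriticalPhenomena.CardyFormulaZ2.Theorems.CardySelfRefinementGradientComparabilityStubBulkPivotalSumDivergesLeaf
import HarnessLib

/-!
# Routing the open skeleton arcs of a quad family around the closed skeleton leaf

Crux `stmt-CriticalPhenomena-10269`
(`Summit.CriticalPhenomena.CardyFormulaZ2.Theses.CardySelfRefinement.GradientComparability`),
line **Sketch**, helper file of the stub `stub_bulkPivotalSum_diverges` (D3-bulk): the geometric
data of the two skeletons showing that the joint crossing event is non-degenerate GIVEN THE
BOUNDARY LAYER.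

## Mathematics

**Theorem (`exists_routes`, registered sub-goal).**  For a nonempty finite quad family `F`, with
straightening charts `H_i` of the `F i` and `H_t` of the transposed first quad `Qt`
(`Quad.exists_straighten`, `Quad.exists_transpose`), there are a leaf `κ = H_t([-2,2] × {a})`,
`|a| < ¼`, chart paths `γ_i : [0,1] → [-2,2] × [-½,½]` from `re = -2` to `re = 2`, and a width
`w > 0` such that NO point of the plane is simultaneously within `w` of the arc `H_i ∘ γ_i`, of
the leaf `κ`, and of the boundaries `∂F = ⋃ᵢ ∂(F i)` (for every `i`).

*Proof.*  `∂F` is closed with empty interior, so by `exists_leaf_subsingleton` some leaf `κ` meets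
`∂F` in a compact set `Z` all of whose connected subsets are points.  In the chart of `F i` the
compact set `H_i⁻¹(Z) ∩ ([-2,2] × [-½,½])` then contains no connected set meeting both horizontal
sides, so (`exists_path_avoiding_of_not_crossed_horizontal`, planar duality in a rectangle) a
path `γ_i` crosses the rectangle from left to right avoiding it: the arc `H_i ∘ γ_i` misses
`Z = κ ∩ ∂F`.  The three compact sets `H_i ∘ γ_i`, `κ`, `∂F` having empty common intersection,
the continuous function `p ↦ d(p, H_i∘γ_i) + d(p, κ) + d(p, ∂F)` has a positive minimum on the
compact `1`-neighbourhood of `κ`, whence `w`.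
-/

noncomputable section

namespace Summit.CriticalPhenomena.CardyFormulaZ2.Theorems.CardySelfRefinement

open scoped Topology
open Filter Set MeasureTheory Metric
open Literature.Probability.Percolation.QuadCrossing
open Literature.Topology.PlaneTopology

/-- **The routed skeleton arcs.** -/
theorem exists_routes (m : ℕ) (F : Fin m → Quad (Set.univ : Set ℂ)) (hm : 0 < m) :
    ∃ w : ℝ, 0 < w ∧
    ∃ (Qt : Quad (Set.univ : Set ℂ)) (Ht : ℂ ≃ₜ ℂ) (a : ℝ),
      Qt.carrier = (F ⟨0, hm⟩).carrier ∧ Qt.side 0 = (F ⟨0, hm⟩).side 1 ∧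
      Qt.side 2 = (F ⟨0, hm⟩).side 3 ∧
      Qt.carrier = Ht '' (Icc (-1 : ℝ) 1 ×ℂ Icc (-1 : ℝ) 1) ∧
      Qt.side 0 = Ht '' {z | z ∈ Icc (-1 : ℝ) 1 ×ℂ Icc (-1 : ℝ) 1 ∧ z.re = -1} ∧
      Qt.side 2 = Ht '' {z | z ∈ Icc (-1 : ℝ) 1 ×ℂ Icc (-1 : ℝ) 1 ∧ z.re = 1} ∧
      a ∈ Ioo (-1 / 4 : ℝ) (1 / 4) ∧
    ∃ (Hc : Fin m → ℂ ≃ₜ ℂ) (γ : Fin m → ℝ → ℂ),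
      (∀ i, (F i).carrier = Hc i '' (Icc (-1 : ℝ) 1 ×ℂ Icc (-1 : ℝ) 1) ∧
        (F i).side 0 = Hc i '' {z | z ∈ Icc (-1 : ℝ) 1 ×ℂ Icc (-1 : ℝ) 1 ∧ z.re = -1} ∧
        (F i).side 2 = Hc i '' {z | z ∈ Icc (-1 : ℝ) 1 ×ℂ Icc (-1 : ℝ) 1 ∧ z.re = 1}) ∧
      (∀ i, ContinuousOn (γ i) (Icc 0 1) ∧
        MapsTo (γ i) (Icc 0 1) (Icc (-2 : ℝ) 2 ×ℂ Icc (-1 / 2 : ℝ) (1 / 2)) ∧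
        (γ i 0).re = -2 ∧ (γ i 1).re = 2) ∧
      ∀ i, ∀ p : ℂ, ∀ u ∈ Icc (0 : ℝ) 1, ∀ y ∈ Ht '' (Icc (-2 : ℝ) 2 ×ℂ {(a : ℝ)}),
        ∀ z ∈ ⋃ i' : Fin m, ⋃ j : Fin 4, (F i').side j,
        dist p (Hc i (γ i u)) < w → dist p y < w → dist p z < w → False := by
  -- the charts
  choose Hc _hsy hcar h0 _h1 h2 _h3 using fun i => (F i).exists_straighten
  obtain ⟨Qt, htcar, ht0, -, ht2, -⟩ := (F ⟨0, hm⟩).exists_transpose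
  obtain ⟨Ht, -, htcar', ht0', -, ht2', -⟩ := Qt.exists_straighten
  set S : Set ℂ := ⋃ i' : Fin m, ⋃ j : Fin 4, (F i').side j with hSdef
  have hS : IsClosed S := isClosed_boundaries m F
  have hSint : interior S = ∅ := interior_boundaries_eq_empty m F
  -- the leaf
  obtain ⟨a, ha, hleaf⟩ := exists_leaf_subsingleton Ht hS hSint
  set κ : Set ℂ := Ht '' (Icc (-2 : ℝ) 2 ×ℂ {(a : ℝ)}) with hκdef
  have hκc : IsCompact κ := (Metric.isCompact_of_isClosed_isBounded
    (isClosed_Icc.reProdIm isClosed_singleton)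
    ((isBounded_Icc _ _).reProdIm Bornology.isBounded_singleton)).image Ht.continuous
  have hZc : IsCompact (κ ∩ S) := hκc.inter_right hS
  have hRc : IsClosed (Icc (-2 : ℝ) 2 ×ℂ Icc (-1 / 2 : ℝ) (1 / 2)) := isClosed_Icc.reProdIm isClosed_Icc
  -- routing
  have hroute : ∀ i, ∃ γ : ℝ → ℂ, ContinuousOn γ (Icc 0 1) ∧
      MapsTo γ (Icc 0 1) (Icc (-2 : ℝ) 2 ×ℂ Icc (-1 / 2 : ℝ) (1 / 2)) ∧
      (γ 0).re = -2 ∧ (γ 1).re = 2 ∧ ∀ u ∈ Icc (0 : ℝ) 1, Hc i (γ u) ∉ κ ∩ S := by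
    intro i
    set 𝒦 : Set ℂ := (Hc i).symm '' (κ ∩ S) ∩ (Icc (-2 : ℝ) 2 ×ℂ Icc (-1 / 2 : ℝ) (1 / 2)) with h𝒦
    have h𝒦c : IsCompact 𝒦 := (hZc.image (Hc i).symm.continuous).inter_right hRc
    obtain ⟨γ, hγc, hγm, hγ0, hγ1, hγ𝒦⟩ := exists_path_avoiding_of_not_crossed_horizontal
      (a := -2) (b := 2) (c := -1 / 2) (d := 1 / 2) (𝒦 := 𝒦) (by norm_num) (by norm_num) h𝒦c
      inter_subset_right (fun C hC hCc ⟨z₁, hz₁, hz₁im⟩ ⟨z₂, hz₂, hz₂im⟩ => by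
        have hsub : Hc i '' C ⊆ κ ∩ S := by
          rintro _ ⟨c, hc, rfl⟩
          obtain ⟨⟨z, hz, hzc⟩, -⟩ := hC hc
          rw [← hzc, Homeomorph.apply_symm_apply]
          exact hz
        have hss := hleaf _ hsub (hCc.image _ (Hc i).continuous.continuousOn)
        have heq : Hc i z₁ = Hc i z₂ := hss (mem_image_of_mem _ hz₁) (mem_image_of_mem _ hz₂)
        have : z₁ = z₂ := (Hc i).injective heq
        rw [this, hz₂im] at hz₁im
        norm_num at hz₁im)
    refine ⟨γ, hγc, hγm, hγ0, hγ1, fun u hu hmem => hγ𝒦 u hu ⟨⟨Hc i (γ u), hmem, ?_⟩, hγm hu⟩⟩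
    rw [Homeomorph.symm_apply_apply]
  choose γ hγc hγm hγ0 hγ1 hγZ using hroute
  -- nonemptiness
  have hκne : κ.Nonempty := ⟨Ht ((0 : ℝ) + (a : ℂ) * Complex.I), mem_image_of_mem _ (by
    rw [Complex.mem_reProdIm]
    constructor
    · simp only [Complex.add_re, Complex.ofReal_re, Complex.mul_re, Complex.I_re, mul_zero,
        Complex.ofReal_im, Complex.I_im, mul_one, sub_self, add_zero, mem_Icc]
      norm_num
    · simp)⟩
  have hSne : S.Nonempty := by
    refine ⟨Hc ⟨0, hm⟩ (-1), ?_⟩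
    simp only [hSdef, mem_iUnion]
    refine ⟨⟨0, hm⟩, 0, ?_⟩
    rw [h0]
    refine ⟨-1, ⟨?_, by simp⟩, rfl⟩
    rw [Complex.mem_reProdIm]
    simp
  -- the width, quad by quad
  have hw : ∀ i, ∃ w : ℝ, 0 < w ∧ ∀ (p : ℂ) (u : ℝ) (y z : ℂ), u ∈ Icc (0 : ℝ) 1 → y ∈ κ → z ∈ S →
      dist p (Hc i (γ i u)) < w → dist p y < w → dist p z < w → False := by
    intro i
    set Γ : Set ℂ := (fun u => Hc i (γ i u)) '' Icc 0 1 with hΓ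
    have hΓc : IsCompact Γ :=
      isCompact_Icc.image_of_continuousOn ((Hc i).continuous.comp_continuousOn (hγc i))
    have hΓne : Γ.Nonempty := ⟨_, mem_image_of_mem _ (left_mem_Icc.2 zero_le_one)⟩
    set f : ℂ → ℝ := fun p => infDist p Γ + infDist p κ + infDist p S with hf
    have hfc : Continuous f :=
      ((continuous_infDist_pt _).add (continuous_infDist_pt _)).add (continuous_infDist_pt _)
    have hCc : IsCompact (cthickening 1 κ) := hκc.cthickening
    have hCne : (cthickening 1 κ).Nonempty := hκne.mono (self_subset_cthickening κ)
    obtain ⟨p₀, hp₀C, hp₀min⟩ := hCc.exists_isMinOn hCne hfc.continuousOn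
    have hfpos : 0 < f p₀ := by
      by_contra hle
      rw [not_lt] at hle
      have h1 : 0 ≤ infDist p₀ Γ := infDist_nonneg
      have h2 : 0 ≤ infDist p₀ κ := infDist_nonneg
      have h3 : 0 ≤ infDist p₀ S := infDist_nonneg
      have hf0 : f p₀ = infDist p₀ Γ + infDist p₀ κ + infDist p₀ S := rfl
      have e1 : infDist p₀ Γ = 0 := by linarith
      have e2 : infDist p₀ κ = 0 := by linarith
      have e3 : infDist p₀ S = 0 := by linarith
      have m1 : p₀ ∈ Γ := (hΓc.isClosed.mem_iff_infDist_zero hΓne).2 e1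
      have m2 : p₀ ∈ κ := (hκc.isClosed.mem_iff_infDist_zero hκne).2 e2
      have m3 : p₀ ∈ S := (hS.mem_iff_infDist_zero hSne).2 e3
      obtain ⟨u, hu, rfl⟩ := m1
      exact hγZ i u hu ⟨m2, m3⟩
    refine ⟨min (f p₀ / 3) 1, by positivity, fun p u y z hu hy hz h1 h2 h3 => ?_⟩
    have hpC : p ∈ cthickening 1 κ :=
      mem_cthickening_of_dist_le p y 1 κ hy (h2.le.trans (min_le_right _ _))
    have hmin : f p₀ ≤ f p := hp₀min hpC
    have i1 : infDist p Γ ≤ dist p (Hc i (γ i u)) := infDist_le_dist_of_mem ⟨u, hu, rfl⟩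
    have i2 : infDist p κ ≤ dist p y := infDist_le_dist_of_mem hy
    have i3 : infDist p S ≤ dist p z := infDist_le_dist_of_mem hz
    have hfp : f p = infDist p Γ + infDist p κ + infDist p S := rfl
    linarith [min_le_left (f p₀ / 3) 1]
  choose wi hwi hwdisj using hw
  have hne : (Finset.univ : Finset (Fin m)).Nonempty := ⟨⟨0, hm⟩, Finset.mem_univ _⟩
  refine ⟨Finset.univ.inf' hne wi, (Finset.lt_inf'_iff hne).2 fun i _ => hwi i, Qt, Ht, a, htcar,
    ht0, ht2, htcar', ht0', ht2', ha, Hc, γ, fun i => ⟨hcar i, h0 i, h2 i⟩,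
    fun i => ⟨hγc i, hγm i, hγ0 i, hγ1 i⟩, fun i p u hu y hy z hz h1 h2 h3 => ?_⟩
  have hle : Finset.univ.inf' hne wi ≤ wi i := Finset.inf'_le _ (Finset.mem_univ i)
  exact hwdisj i p u y z hu hy hz (lt_of_lt_of_le h1 hle) (lt_of_lt_of_le h2 hle)
    (lt_of_lt_of_le h3 hle)

end Summit.CriticalPhenomena.CardyFormulaZ2.Theorems.CardySelfRefinement

end
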